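import Literature.AlgebraicGeometry.Resolution.HenselizationDegree
import Literature.AlgebraicGeometry.Resolution.HenselizationImmediateProofs
import Literature.AlgebraicGeometry.Resolution.DefectTransport
import Literature.AlgebraicGeometry.Resolution.GeneralizedStabilityProofs
import Literature.AlgebraicGeometry.Resolution.SubfieldTransport
import HarnessLib

/-!
# Kuhlmann 2010, Thm. 2.14: a valued field is defectless iff its henselization is — discharge of `Kuhlmann2010DefectlessIffHenselization`

Topic: `Literature/AlgebraicGeometry/Resolution` (valued function fields). D-0014 keeps
`Literature/` sorry-free by stating cited results as named facts `def X : Prop`; this sibling of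
`Henselization.lean` PROVES its named fact `Kuhlmann2010DefectlessIffHenselization` =
F.-V. Kuhlmann, *Elimination of ramification I: The generalized stability theorem*, Trans. AMS
362 (2010) 5697–5727 = arXiv:1003.5678, **Theorem 2.14**:

> Take a valued field `(K,v)` and fix an extension of `v` to `K̃`. Then `(K,v)` is defectless
> if and only if its henselization `(K,v)^h` in `(K̃,v)` is defectless.
> *Proof.* For "separably defectless", our assertion follows directly from [En], Theorem (18.2).
> The proof of that theorem can easily be adapted to prove the assertion for … "defectless".
> See [K6] for more details.

([En] = O. Endler, *Valuation theory*, Springer 1972; [K6] = F.-V. Kuhlmann, *A classification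
of Artin–Schreier defect extensions and characterizations of defectless fields*, Illinois J.
Math. 54 (2010).) In the ambient rendering of `Henselization.lean` (`Ω` algebraically closed
with valuation ring `V`, `K ≤ Ω` valued by `V ∩ K`, `K^h = henselization V K ⊆ K^sep ⊆ Ω`):
`IsDefectlessField K (V ∩ K) ↔ IsDefectlessField K^h (V ∩ K^h)`.

## Proof (the classical one behind [En] (18.2))

Fix a finite extension `L | K` and let `O₁, …, O_g` be the extensions of `V ∩ K` to `L`
(finitely many, `FundamentalInequality_holds`). Each `Oᵢ` is `ιᵢ⁻¹(V)` for a `K`-embedding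
`ιᵢ : L → Ω` (`exists_algHom_comap_eq`, `HenselizationDegree.lean`), and with the compositum
`Mᵢ = K^h(ιᵢ(L)) ⊆ Ω`:

1. `∑ᵢ [Mᵢ : K^h] = [L : K]` — the **degree formula** (`sum_finrank_adjoin_eq_finrank`,
   `HenselizationDegree.lean`: the `[L : K]_s` embeddings `L → Ω` fall into classes according
   to the valuation ring they induce, the class of `ιᵢ` has `#Hom_{K^h}(Mᵢ, Ω) = [Mᵢ : K^h]_s`
   elements because `Gal(K̃ | K^h)` is the decomposition group, and `[Mᵢ : K^h]_i = [L : K]_i`).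
2. `e(Oᵢ | K) f(Oᵢ | K) = e(V ∩ Mᵢ | K^h) f(V ∩ Mᵢ | K^h)`
   (`ramificationIndex_mul_inertiaDegree_comap_eq`): transport along `L ≅ ιᵢ(L)`
   (`DefectTransport.lean`), the tower laws for `e` and `f` (`GeneralizedStability.lean`) in
   `K ⊆ ιᵢ(L) ⊆ Mᵢ` and `K ⊆ K^h ⊆ Mᵢ`, and `e = f = 1` for the IMMEDIATE extensions `K^h | K`
   and `ιᵢ(L)^h | ιᵢ(L) ⊇ Mᵢ | ιᵢ(L)` (Lemma 2.2, `Kuhlmann2010HenselizationImmediate_holds`,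
   `HenselizationImmediateProofs.lean`; `Mᵢ ⊆ ιᵢ(L)^h` because the henselization is monotone,
   `K^h` being henselian — Lemma 2.3, `Kuhlmann2010HenselizationIsHenselian_holds`,
   `HenselizationHenselian.lean`).
3. `V ∩ Mᵢ` is the ONLY extension of `V ∩ K^h` to `Mᵢ` (`K^h` henselian), so "`K^h` defectless
   in `Mᵢ`" reads `e(V ∩ Mᵢ | K^h) f(V ∩ Mᵢ | K^h) = [Mᵢ : K^h]` (Cor. 2.15,
   `isDefectlessIn_henselization_iff`), and in any case `≤` holds (fundamental inequality).

`⇐` (`isDefectlessIn_of_isDefectlessField_henselization`): if `K^h` is defectless,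
`∑ᵢ e f = ∑ᵢ [Mᵢ : K^h] = [L : K]`. `⇒` (`isDefectlessIn_adjoin_of_isDefectlessIn`): if `K` is
defectless in `L`, `[L : K] = ∑ᵢ e f ≤ ∑ᵢ [Mᵢ : K^h] = [L : K]` forces equality termwise; and
every finite extension `L'` of `K^h` is `K^h`-isomorphic, as a valued field
(`IsDefectlessIn.congr`), to `K^h(ι(L))` for `L = K(basis of L') ⊆ L'` finite over `K` and
`ι` a `K^h`-embedding of `L'` into `Ω` restricted to `L`
(`Kuhlmann2010DefectlessIffHenselization.of_immediate`, `…_holds`).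

## Sources

* F.-V. Kuhlmann, Trans. AMS 362 (2010) = arXiv:1003.5678: §1 (p. 3, defectless fields, the
  fundamental inequality), Lemma 2.2, Lemma 2.3, §2.3 (Thm. 2.14, Cor. 2.15, Cor. 2.16).
* O. Endler, *Valuation theory* (1972), §17 and Thm. (18.2) — the source's reference.

## Rendering notes

* As in `ValuationDefect.lean`, an extension of valued fields is `[Algebra K L]` plus a valuation
  ring of `L`; the extensions of `V ∩ K` to `L` are the `O'` with `O' ∩ K = V ∩ K`
  (`O'.comap (algebraMap K L) = V.comap (algebraMap K Ω)`).
* `e = f = 1` for immediate extensions is proved for the ambient data the named fact provides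
  (`ramificationIndex_eq_one_of_forall_exists`, `inertiaDegree_eq_one_of_forall_exists`).
-/

noncomputable section

open IsLocalRing
open scoped Pointwise

namespace Literature.AlgebraicGeometry.Resolution

universe u

/-! ### Immediate extensions have `e = f = 1` -/

section Immediate

variable {Ω : Type u} [Field Ω] (V : ValuationSubring Ω)
variable {E' F' : Type u} [Field E'] [Field F'] [Algebra E' F'] [Algebra F' Ω] [Algebra E' Ω]
  [IsScalarTower E' F' Ω]

/-- If every value of `F'` (inside `(Ω, V)`) is the value of an element of `E'`, then
`e(V ∩ F' | E') = 1`. [folklore] -/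
theorem ramificationIndex_eq_one_of_forall_exists
    (hv : ∀ a : F', a ≠ 0 → ∃ c : E',
      V.valuation (algebraMap F' Ω a) = V.valuation (algebraMap E' Ω c)) :
    ramificationIndex E' (V.comap (algebraMap F' Ω)) = 1 := by
  unfold ramificationIndex
  rw [Subgroup.index_eq_one]
  refine eq_top_iff.mpr fun γ _ => ?_
  obtain ⟨a, ha⟩ := (V.comap (algebraMap F' Ω)).valuation_surjective
    (γ : ValuationSubring.ValueGroup (V.comap (algebraMap F' Ω)))
  have ha0 : a ≠ 0 := fun h => by
    rw [h, map_zero] at ha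
    exact γ.ne_zero ha.symm
  obtain ⟨c, hc⟩ := hv a ha0
  have hc0 : c ≠ 0 := by
    rintro rfl
    rw [map_zero, map_zero, Valuation.zero_iff] at hc
    exact ha0 ((map_eq_zero_iff _ (algebraMap F' Ω).injective).mp hc)
  refine (mem_valueSubgroup_iff E' _ γ).mpr ⟨c, hc0, ?_⟩
  rw [← ha]
  rw [IsScalarTower.algebraMap_apply E' F' Ω c] at hc
  exact (valuation_map_eq_iff (algebraMap F' Ω) (V := V.comap (algebraMap F' Ω)) (V' := V)
    rfl a _).mp hc

/-- If every element of `V ∩ F'` is congruent modulo `𝔪(V)` to an element of `E'`, then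
`f(V ∩ F' | E') = 1`. [folklore] -/
theorem inertiaDegree_eq_one_of_forall_exists
    (hr : ∀ a : F', algebraMap F' Ω a ∈ V → ∃ c : E',
      V.valuation (algebraMap F' Ω a - algebraMap E' Ω c) < 1) :
    inertiaDegree E' (V.comap (algebraMap F' Ω)) = 1 := by
  unfold inertiaDegree
  have htop : residueSubfield E' (V.comap (algebraMap F' Ω)) = ⊤ := by
    set O := V.comap (algebraMap F' Ω) with hO
    refine eq_top_iff.mpr fun r _ => ?_
    obtain ⟨a, rfl⟩ := IsLocalRing.residue_surjective r
    obtain ⟨c, hc⟩ := hr a a.2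
    rw [IsScalarTower.algebraMap_apply E' F' Ω c, ← map_sub] at hc
    have hlt : O.valuation ((a : F') - algebraMap E' F' c) < 1 :=
      (valuation_map_lt_one_iff (algebraMap F' Ω) (V := O) (V' := V) rfl _).mp hc
    have hcO : algebraMap E' F' c ∈ O := by
      have h1 : algebraMap E' F' c = (a : F') - ((a : F') - algebraMap E' F' c) := by ring
      rw [← O.valuation_le_one_iff, h1]
      refine (O.valuation.map_sub _ _).trans (max_le ?_ hlt.le)
      exact (O.valuation_le_one_iff _).mpr a.2
    have heq : IsLocalRing.residue O a = IsLocalRing.residue O ⟨algebraMap E' F' c, hcO⟩ := by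
      rw [← sub_eq_zero, ← map_sub, IsLocalRing.residue_eq_zero_iff,
        ValuationSubring.valuation_lt_one_iff]
      exact hlt
    rw [heq]
    exact residue_mem_residueSubfield E' O c hcO
  rw [htop]
  have h := Algebra.finrank_eq_of_equiv_equiv
    (Subfield.topEquiv : (⊤ : Subfield (ResidueField (V.comap (algebraMap F' Ω)))) ≃+*
      ResidueField (V.comap (algebraMap F' Ω)))
    (RingEquiv.refl (ResidueField (V.comap (algebraMap F' Ω)))) (by ext; rfl)
  rw [h, Module.finrank_self]

end Immediate

/-! ### `e(ι⁻¹V | K) f(ι⁻¹V | K) = e(V ∩ M | K^h) f(V ∩ M | K^h)` for `ι(L) ⊆ M ⊆ ι(L)^h` -/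

section EF

variable {Ω : Type u} [Field Ω] [IsAlgClosed Ω] (V : ValuationSubring Ω) (K : Subfield Ω)
variable {L : Type u} [Field L] [Algebra K L]

omit [IsAlgClosed Ω] in
/-- `K ⊆ ι(L)` for a `K`-embedding `ι`. [folklore] -/
theorem le_toSubfield_fieldRange (ι : L →ₐ[K] Ω) : K ≤ (ι.fieldRange).toSubfield :=
  fun c hc => AlgHom.mem_fieldRange.mpr ⟨algebraMap K L ⟨c, hc⟩, ι.commutes ⟨c, hc⟩⟩

/-- `K^h(ι(L)) ⊆ (ι(L))^h` (the henselization is monotone, `K^h` being henselian —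
`Kuhlmann2010HenselizationIsHenselian_holds`, `HenselizationHenselian.lean`).
[cite: Kuhlmann2010, Lemma 2.3] -/
theorem adjoin_toSubfield_le_henselization {n : ℕ} (b : Module.Basis (Fin n) K L)
    (ι : L →ₐ[K] Ω) :
    (IntermediateField.adjoin (henselization V K) (Set.range (ι ∘ b))).toSubfield ≤
      henselization V (ι.fieldRange).toSubfield := by
  rw [IntermediateField.adjoin_toSubfield, Subfield.closure_le]
  rintro x (⟨c, rfl⟩ | ⟨i, rfl⟩)
  · exact henselization_mono V Kuhlmann2010HenselizationIsHenselian_holds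
      (le_toSubfield_fieldRange K ι) c.2
  · exact le_henselization V _ (AlgHom.mem_fieldRange.mpr ⟨b i, rfl⟩)

/-- `e(V ∩ K^h | K) = f(V ∩ K^h | K) = 1`, from the immediateness of the henselization
(`Kuhlmann2010HenselizationImmediate`, Lemma 2.2). [cite: Kuhlmann2010, Lemma 2.2] -/
theorem ramificationIndex_inertiaDegree_henselization_eq_one
    (hC : Kuhlmann2010HenselizationImmediate.{u}) :
    ramificationIndex K (V.comap (algebraMap (henselization V K) Ω)) = 1 ∧
      inertiaDegree K (V.comap (algebraMap (henselization V K) Ω)) = 1 := by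
  obtain ⟨hval, hres⟩ := hC Ω V K
  refine ⟨ramificationIndex_eq_one_of_forall_exists V fun a ha0 => ?_,
    inertiaDegree_eq_one_of_forall_exists V fun a haV => ?_⟩
  · obtain ⟨c, hcK, hc⟩ := hval (a : Ω) a.2 (fun h => ha0 (Subtype.ext h))
    exact ⟨⟨c, hcK⟩, hc⟩
  · have hr : residue V ⟨(a : Ω), haV⟩ ∈ resField V K :=
      hres (residue_mem_resField V ⟨(a : Ω), haV⟩ a.2)
    obtain ⟨a', ha'K, ha'⟩ := (mem_resField_iff V K _).mp hr
    refine ⟨⟨(a' : Ω), ha'K⟩, ?_⟩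
    have hsub : residue V (⟨(a : Ω), haV⟩ - a') = 0 := by rw [map_sub, ← ha', sub_self]
    rw [residue_eq_zero_iff, ValuationSubring.valuation_lt_one_iff] at hsub
    exact hsub

/-- **`e(ι⁻¹V | K) f(ι⁻¹V | K) = e(V ∩ M | K^h) f(V ∩ M | K^h)`** for a `K`-embedding `ι`
of `L` and an intermediate field `M` of `Ω | K^h` with `ι(L) ⊆ M ⊆ (ι(L))^h`: transport along
`L ≅ ι(L)`, the tower laws for `e`, `f`, and `e = f = 1` for the immediate extensions
`K^h | K` and `(ι(L))^h | ι(L)` (Lemma 2.2). PROVED. [cite: Kuhlmann2010, Lemma 2.2] -/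
theorem ramificationIndex_mul_inertiaDegree_comap_eq
    (hC : Kuhlmann2010HenselizationImmediate.{u})
    (ι : L →ₐ[K] Ω) (M : IntermediateField (henselization V K) Ω) (hM : ∀ y, ι y ∈ M)
    (hMh : M.toSubfield ≤ henselization V (ι.fieldRange).toSubfield) :
    ramificationIndex K (V.comap ι.toRingHom) * inertiaDegree K (V.comap ι.toRingHom) =
      ramificationIndex (henselization V K) (V.comap (algebraMap M Ω)) *
        inertiaDegree (henselization V K) (V.comap (algebraMap M Ω)) := by
  let F : IntermediateField K Ω := ι.fieldRange
  let e : L ≃ₐ[K] F := AlgEquiv.ofInjectiveField ι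
  -- (a) transport along `L ≅ ι(L)`
  have hW : V.comap ι.toRingHom = (V.comap (algebraMap F Ω)).comap e.toRingEquiv.toRingHom := by
    ext y
    rfl
  have hc : ∀ x : K, e.toRingEquiv (algebraMap K L x) = algebraMap K F (RingEquiv.refl K x) :=
    fun x => Subtype.ext (ι.commutes x)
  have ea := ramificationIndex_congr (RingEquiv.refl K) e.toRingEquiv hc hW
  have fa := inertiaDegree_congr (RingEquiv.refl K) e.toRingEquiv hc hW
  -- (b) the towers `K → ι(L) → M` and `K → K^h → M`
  have hFM' : ∀ x : F, (x : Ω) ∈ M := by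
    rintro ⟨_, y, rfl⟩
    exact hM y
  letI : Algebra F M := ((algebraMap F Ω).codRestrict M hFM').toAlgebra
  haveI : IsScalarTower K F M := IsScalarTower.of_algebraMap_eq fun _ => rfl
  haveI : IsScalarTower F M Ω := IsScalarTower.of_algebraMap_eq fun _ => rfl
  have hFM : (V.comap (algebraMap M Ω)).comap (algebraMap F M) = V.comap (algebraMap F Ω) := by
    ext
    rfl
  have hKhM : (V.comap (algebraMap M Ω)).comap (algebraMap (henselization V K) M) =
      V.comap (algebraMap (henselization V K) Ω) := by
    ext
    rfl
  have eF := ramificationIndex_tower K F (V.comap (algebraMap M Ω))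
  have fF := inertiaDegree_tower K F (V.comap (algebraMap M Ω))
  have eKh := ramificationIndex_tower K (henselization V K) (V.comap (algebraMap M Ω))
  have fKh := inertiaDegree_tower K (henselization V K) (V.comap (algebraMap M Ω))
  rw [hFM] at eF fF
  rw [hKhM] at eKh fKh
  -- (c) immediateness of `K^h | K` and of `(ι(L))^h | ι(L) ⊇ M | ι(L)`
  obtain ⟨e1, f1⟩ := ramificationIndex_inertiaDegree_henselization_eq_one V K hC
  obtain ⟨hval, hres⟩ := hC Ω V F.toSubfield
  have e2 : ramificationIndex F (V.comap (algebraMap M Ω)) = 1 := by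
    refine ramificationIndex_eq_one_of_forall_exists V fun m hm0 => ?_
    obtain ⟨c, hcF, hc⟩ := hval (m : Ω) (hMh m.2) (fun h => hm0 (Subtype.ext h))
    exact ⟨⟨c, hcF⟩, hc⟩
  have f2 : inertiaDegree F (V.comap (algebraMap M Ω)) = 1 := by
    refine inertiaDegree_eq_one_of_forall_exists V fun m hmV => ?_
    have hr : residue V ⟨(m : Ω), hmV⟩ ∈ resField V F.toSubfield :=
      hres (residue_mem_resField V ⟨(m : Ω), hmV⟩ (hMh m.2))
    obtain ⟨a', ha'F, ha'⟩ := (mem_resField_iff V F.toSubfield _).mp hr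
    refine ⟨⟨(a' : Ω), ha'F⟩, ?_⟩
    have hsub : residue V (⟨(m : Ω), hmV⟩ - a') = 0 := by rw [map_sub, ← ha', sub_self]
    rw [residue_eq_zero_iff, ValuationSubring.valuation_lt_one_iff] at hsub
    exact hsub
  -- (d) assemble
  calc ramificationIndex K (V.comap ι.toRingHom) * inertiaDegree K (V.comap ι.toRingHom)
      = ramificationIndex K (V.comap (algebraMap F Ω)) *
          inertiaDegree K (V.comap (algebraMap F Ω)) := by rw [ea, fa]
    _ = ramificationIndex K (V.comap (algebraMap M Ω)) *
          inertiaDegree K (V.comap (algebraMap M Ω)) := by rw [eF, fF, e2, f2, mul_one, mul_one]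
    _ = _ := by rw [eKh, fKh, e1, f1, one_mul, one_mul]

/-- **Uniqueness of the valuation ring on an algebraic extension of `K^h` inside `Ω`**: the
only valuation ring of `M ⊇ K^h` over `V ∩ K^h` is `V ∩ M` (`K^h` is henselian,
`Kuhlmann2010HenselizationIsHenselian_holds`). [cite: Kuhlmann2010, Lemma 2.3] -/
theorem valuationSubring_eq_comap_of_comap_eq (M : IntermediateField (henselization V K) Ω)
    [Algebra.IsAlgebraic (henselization V K) M] (O'' : ValuationSubring M)
    (h : O''.comap (algebraMap (henselization V K) M) =
      V.comap (algebraMap (henselization V K) Ω)) :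
    O'' = V.comap (algebraMap M Ω) :=
  (Kuhlmann2010HenselizationIsHenselian_holds Ω V K).eq_of_comap_eq h (by ext; rfl)

/-- Over the henselian `K^h`, "defectless in `M`" (for `K^h ⊆ M ⊆ Ω` finite) reads
`e(V ∩ M | K^h)·f(V ∩ M | K^h) = [M : K^h]` (Cor. 2.15: "A valued field `(K,v)` is defectless
if and only if `d(L|K^h,v) = 1` for every finite extension `L|K^h`"). PROVED.
[cite: Kuhlmann2010, Cor. 2.15] -/
theorem isDefectlessIn_henselization_iff (M : IntermediateField (henselization V K) Ω)
    [FiniteDimensional (henselization V K) M] :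
    IsDefectlessIn (henselization V K) (V.comap (algebraMap (henselization V K) Ω)) M ↔
      ramificationIndex (henselization V K) (V.comap (algebraMap M Ω)) *
        inertiaDegree (henselization V K) (V.comap (algebraMap M Ω)) =
        Module.finrank (henselization V K) M := by
  classical
  have hiff : ∀ O'' : ValuationSubring M,
      O'' ∈ ({V.comap (algebraMap M Ω)} : Finset (ValuationSubring M)) ↔
        O''.comap (algebraMap (henselization V K) M) =
          V.comap (algebraMap (henselization V K) Ω) := by
    intro O''
    rw [Finset.mem_singleton]
    constructor
    · rintro rfl
      ext
      rfl
    · exact valuationSubring_eq_comap_of_comap_eq V K M O''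
  constructor
  · rintro ⟨t, ht, hsum⟩
    have htt : t = {V.comap (algebraMap M Ω)} := by
      ext O''
      rw [ht, hiff]
    rwa [htt, Finset.sum_singleton] at hsum
  · intro h
    exact ⟨{V.comap (algebraMap M Ω)}, hiff, by rwa [Finset.sum_singleton]⟩

end EF

/-! ### Theorem 2.14 -/

section Main

variable {Ω : Type u} [Field Ω] [IsAlgClosed Ω] (V : ValuationSubring Ω) (K : Subfield Ω)
variable {L : Type u} [Field L] [Algebra K L] [FiniteDimensional K L]

/-- For a finite extension `L | K`, the set `s` of extensions of `V ∩ K` to `L` and embeddings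
`ι_{O'}` inducing them: `e(O'|K) f(O'|K) ≤ [K^h(ι_{O'}(L)) : K^h]` termwise (fundamental
inequality for the unique extension to `K^h(ι_{O'}(L))`), the sum of the right-hand sides being
`[L : K]` (`sum_finrank_adjoin_eq_finrank`). PROVED. [cite: Kuhlmann2010, Thm. 2.14] -/
theorem ramificationIndex_mul_inertiaDegree_le_finrank_adjoin
    (hC : Kuhlmann2010HenselizationImmediate.{u}) (ι : L →ₐ[K] Ω) :
    ramificationIndex K (V.comap ι.toRingHom) * inertiaDegree K (V.comap ι.toRingHom) ≤
      Module.finrank (henselization V K) (IntermediateField.adjoin (henselization V K)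
        (Set.range (ι ∘ Module.finBasis K L))) := by
  haveI := finiteDimensional_adjoin_henselization V K (Module.finBasis K L) ι
  rw [ramificationIndex_mul_inertiaDegree_comap_eq V K hC ι _
    (algHom_apply_mem_adjoin V K (Module.finBasis K L) ι)
    (adjoin_toSubfield_le_henselization V K (Module.finBasis K L) ι)]
  exact (ramificationIndex_mul_inertiaDegree_le_finrank (henselization V K) _).2.2

/-- **Kuhlmann 2010, Thm. 2.14, `⇐`**: if `K^h` is a defectless field then `V ∩ K` is
defectless in every finite extension `L` of `K`:
`∑ e f = ∑ e(V ∩ M_{O'} | K^h) f(V ∩ M_{O'} | K^h) = ∑ [M_{O'} : K^h] = [L : K]`.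
PROVED. [cite: Kuhlmann2010, Thm. 2.14] -/
theorem isDefectlessIn_of_isDefectlessField_henselization
    (hC : Kuhlmann2010HenselizationImmediate.{u})
    (hdef : IsDefectlessField (henselization V K) (V.comap (algebraMap (henselization V K) Ω))) :
    IsDefectlessIn K (V.comap (algebraMap K Ω)) L := by
  classical
  obtain ⟨s, hs, -⟩ := FundamentalInequality_holds K L inferInstance (V.comap (algebraMap K Ω))
  have hrep : ∀ O' : ValuationSubring L, ∃ ι : L →ₐ[K] Ω,
      O' ∈ s → V.comap ι.toRingHom = O' := by
    intro O'
    by_cases hO' : O' ∈ s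
    · obtain ⟨ι, hι⟩ := exists_algHom_comap_eq V K O' ((hs O').mp hO')
      exact ⟨ι, fun _ => hι⟩
    · haveI : IsAlgClosed (algebraicClosure K Ω) := IsAlgClosure.isAlgClosed K
      exact ⟨IsAlgClosed.lift, fun h => (hO' h).elim⟩
  choose rep hrep using hrep
  refine ⟨s, hs, ?_⟩
  rw [← sum_finrank_adjoin_eq_finrank V K (Module.finBasis K L) s hs rep hrep]
  refine Finset.sum_congr rfl fun O' hO' => ?_
  haveI := finiteDimensional_adjoin_henselization V K (Module.finBasis K L) (rep O')
  conv_lhs => rw [← hrep O' hO']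
  rw [ramificationIndex_mul_inertiaDegree_comap_eq V K hC (rep O') _
    (algHom_apply_mem_adjoin V K (Module.finBasis K L) (rep O'))
    (adjoin_toSubfield_le_henselization V K (Module.finBasis K L) (rep O'))]
  exact (isDefectlessIn_henselization_iff V K _).mp (hdef _ inferInstance)

/-- **Kuhlmann 2010, Thm. 2.14, `⇒` (finite level)**: if `V ∩ K` is defectless in the finite
extension `L` and `ι` is a `K`-embedding of `L` into `Ω`, then `V ∩ K^h` is defectless in
`K^h(ι(L))`: `[L : K] = ∑ e f ≤ ∑ [M_{O'} : K^h] = [L : K]` forces equality termwise, in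
particular at `O' = ι⁻¹(V)`. PROVED. [cite: Kuhlmann2010, Thm. 2.14] -/
theorem isDefectlessIn_adjoin_of_isDefectlessIn (hC : Kuhlmann2010HenselizationImmediate.{u})
    (hdef : IsDefectlessIn K (V.comap (algebraMap K Ω)) L) (ι : L →ₐ[K] Ω) :
    IsDefectlessIn (henselization V K) (V.comap (algebraMap (henselization V K) Ω))
      (IntermediateField.adjoin (henselization V K) (Set.range (ι ∘ Module.finBasis K L))) := by
  classical
  obtain ⟨s, hs, hsum⟩ := hdef
  have hιs : V.comap ι.toRingHom ∈ s := by
    rw [hs]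
    ext c
    change ι (algebraMap K L c) ∈ V ↔ (c : Ω) ∈ V
    rw [ι.commutes]
    rfl
  have hrep : ∀ O' : ValuationSubring L, ∃ ι' : L →ₐ[K] Ω,
      (O' ∈ s → V.comap ι'.toRingHom = O') ∧ (O' = V.comap ι.toRingHom → ι' = ι) := by
    intro O'
    by_cases hO'ι : O' = V.comap ι.toRingHom
    · exact ⟨ι, fun _ => hO'ι.symm, fun _ => rfl⟩
    by_cases hO' : O' ∈ s
    · obtain ⟨ι', hι'⟩ := exists_algHom_comap_eq V K O' ((hs O').mp hO')
      exact ⟨ι', fun _ => hι', fun h => (hO'ι h).elim⟩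
    · exact ⟨ι, fun h => (hO' h).elim, fun h => (hO'ι h).elim⟩
  choose rep hrep hrepι using hrep
  haveI := finiteDimensional_adjoin_henselization V K (Module.finBasis K L) ι
  have htot := (sum_finrank_adjoin_eq_finrank V K (Module.finBasis K L) s hs rep hrep).trans
    hsum.symm
  have hle : ∀ O' ∈ s, ramificationIndex K O' * inertiaDegree K O' ≤
      Module.finrank (henselization V K) (IntermediateField.adjoin (henselization V K)
        (Set.range (rep O' ∘ Module.finBasis K L))) := by
    intro O' hO'
    have h := ramificationIndex_mul_inertiaDegree_le_finrank_adjoin V K hC (rep O')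
    rwa [hrep O' hO'] at h
  have hterm := (Finset.sum_eq_sum_iff_of_le hle).mp htot.symm _ hιs
  rw [hrepι _ rfl] at hterm
  rw [isDefectlessIn_henselization_iff,
    ← ramificationIndex_mul_inertiaDegree_comap_eq V K hC ι _
      (algHom_apply_mem_adjoin V K (Module.finBasis K L) ι)
      (adjoin_toSubfield_le_henselization V K (Module.finBasis K L) ι)]
  exact hterm

end Main

/-- **Kuhlmann 2010, Thm. 2.14, from Lemma 2.2 (immediateness of the henselization).** "Take a
valued field `(K,v)` and fix an extension of `v` to `K̃`. Then `(K,v)` is defectless if and only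
if its henselization `(K,v)^h` in `(K̃,v)` is defectless." PROVED from the named fact
`Kuhlmann2010HenselizationImmediate` (Lemma 2.2: `K^h | K` is immediate, for every `K ≤ Ω`),
everything else being proved in this topic: conjugacy of the extensions
(`ValuationConjugation.lean`, `ValuationConjugacyNormal.lean`), `K^h` henselian
(`HenselizationHenselian.lean`), the degree formula `∑ [K^h ι(L) : K^h] = [L : K]`
(`HenselizationDegree.lean`), the fundamental inequality (`GeneralizedStabilityProofs.lean`).
`⇐`: `isDefectlessIn_of_isDefectlessField_henselization`. `⇒`: a finite extension `L'` of
`K^h` is `K^h`-isomorphic, as a valued field, to `K^h(ι(L))` for the finite extension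
`L = K(basis of L') ⊆ L'` of `K` and a `K^h`-embedding `ι` of `L'` into `Ω`
(`IsDefectlessIn.congr`, `DefectTransport.lean`), to which
`isDefectlessIn_adjoin_of_isDefectlessIn` applies. [cite: Kuhlmann2010, Thm. 2.14] -/
theorem Kuhlmann2010DefectlessIffHenselization.of_immediate
    (hC : Kuhlmann2010HenselizationImmediate.{u}) :
    Kuhlmann2010DefectlessIffHenselization.{u} := by
  intro Ω _ _ V K
  constructor
  · intro hdef L' _ _ hfin
    haveI := hfin
    -- `L'` as an extension of `K`, and the finite subextension `L = K(basis)`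
    letI : Algebra K L' := ((algebraMap (henselization V K) L').comp
      (algebraMap K (henselization V K))).toAlgebra
    haveI : IsScalarTower K (henselization V K) L' := IsScalarTower.of_algebraMap_eq fun _ => rfl
    haveI := isAlgebraic_henselization V K
    haveI : Algebra.IsAlgebraic K L' := Algebra.IsAlgebraic.trans K (henselization V K) L'
    let b' := Module.finBasis (henselization V K) L'
    let L : IntermediateField K L' := IntermediateField.adjoin K (Set.range b')
    haveI : FiniteDimensional K L := IntermediateField.finiteDimensional_adjoin fun x _ =>
      (Algebra.IsAlgebraic.isAlgebraic (R := K) x).isIntegral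
    -- an embedding of `L'` into `Ω` over `K^h`, restricted to `L`
    let ι' : L' →ₐ[henselization V K] Ω := IsAlgClosed.lift
    let ι : L →ₐ[K] Ω := (ι'.restrictScalars K).comp (IsScalarTower.toAlgHom K L L')
    have hιι' : ∀ x : L, ι x = ι' (x : L') := fun _ => rfl
    -- `ι'(L') = K^h(ι(L))`
    have hrange : ι'.fieldRange = IntermediateField.adjoin (henselization V K)
        (Set.range (ι ∘ Module.finBasis K L)) := by
      apply le_antisymm
      · intro x hx
        obtain ⟨z, rfl⟩ := AlgHom.mem_fieldRange.mp hx
        have hz : z = ∑ j, b'.repr z j • b' j := (b'.sum_repr z).symm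
        rw [hz, map_sum]
        refine sum_mem fun j _ => ?_
        rw [map_smul, Algebra.smul_def]
        refine mul_mem (IntermediateField.algebraMap_mem _ _) ?_
        have hbj : b' j ∈ L := IntermediateField.subset_adjoin K _ ⟨j, rfl⟩
        rw [show ι' (b' j) = ι ⟨b' j, hbj⟩ from rfl]
        exact algHom_apply_mem_adjoin V K (Module.finBasis K L) ι _
      · rw [IntermediateField.adjoin_le_iff]
        rintro _ ⟨i, rfl⟩
        exact AlgHom.mem_fieldRange.mpr ⟨_, (hιι' _).symm⟩
    let Θ : L' ≃ₐ[henselization V K] IntermediateField.adjoin (henselization V K)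
        (Set.range (ι ∘ Module.finBasis K L)) :=
      (AlgEquiv.ofInjectiveField ι').trans (IntermediateField.equivOfEq hrange)
    have hL : IsDefectlessIn K (V.comap (algebraMap K Ω)) L := hdef L inferInstance
    have hM := isDefectlessIn_adjoin_of_isDefectlessIn V K hC hL ι
    refine IsDefectlessIn.congr (RingEquiv.refl (henselization V K)) Θ.symm.toRingEquiv
      (fun x => ?_) (by ext; rfl) hM
    change Θ.symm (algebraMap (henselization V K) _ x) = algebraMap (henselization V K) L' x
    exact Θ.symm.commutes x
  · intro hdef L _ _ hfin
    haveI := hfin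
    exact isDefectlessIn_of_isDefectlessField_henselization V K hC hdef

/-- **Kuhlmann 2010, Thm. 2.14** — discharge of the named fact
`Kuhlmann2010DefectlessIffHenselization` (`Henselization.lean`): "Take a valued field `(K,v)` and
fix an extension of `v` to `K̃`. Then `(K,v)` is defectless if and only if its henselization
`(K,v)^h` in `(K̃,v)` is defectless." PROVED (`…of_immediate` with Lemma 2.2,
`Kuhlmann2010HenselizationImmediate_holds`). [cite: Kuhlmann2010, Thm. 2.14] -/
theorem Kuhlmann2010DefectlessIffHenselization_holds :
    Kuhlmann2010DefectlessIffHenselization.{u} :=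
  Kuhlmann2010DefectlessIffHenselization.of_immediate Kuhlmann2010HenselizationImmediate_holds

end Literature.AlgebraicGeometry.Resolution
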